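import Summits.NavierStokesRegularity.NavierStokesRegularity.Theorems.SoloSalvageWu2026PressureCompactLocal
import Summits.NavierStokesRegularity.NavierStokesRegularity.Theorems.SoloSalvageWu2026ConstructCompactTools
import HarnessLib

/-!
# C177 `Wu2026` — toward `Step_construct` (B), pressure compactness (3.45): the countable good-ball
# cover of `ℝ³ ∖ {0}` and the gluing of ball-wise `L²` limits into one `L²_loc` limit

Seat `ns-in-wu-341` on sub-binder (B) of `step_construct_of_pieces` (`SoloSalvageWu2026Construct`,
seat `ns-in-wu-con`; cut owner `ns-inputs-plan` g5 ruling 07:43Z: «wu-341 TAKES sub-binder (B) =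
hypothesis (B) VERBATIM … name the final theorem `step_construct_pieceB`»). Salvage conventions:
theorems only, standard axioms, no definition, no named fact; `--supports` item 0897.

Print (arXiv:2608.22471v1, p.15 l.17 – p.16 l.27): local split `P_j = L_j + H_j` on
`K ⋐ U ⋐ U′ ⋐ ℝ³∖{0}`, `L_j → L` by Calderón–Zygmund, `H_j` harmonic and bounded in `L^{q₀/2}(U)`,
«By Arzelà–Ascoli, followed by a diagonal argument over both m and a nested exhaustion of
R³∖{0}, we may pass to a subsequence such that H_j converges … Consequently, there is a function P
such that P_j → P strongly in L^{q₀/2}_loc(R³∖{0}). (3.45)» (`q₀ = 4`).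

This file holds the measure-theoretic bookkeeping of the «diagonal argument over … a nested
exhaustion of R³∖{0}» that does not involve the flow:
* `exists_goodBalls` — a sequence of balls `B(c_k, r_k)` with `B̄(c_k, 3r_k) ⊆ ℝ³∖{0}` covering
  `ℝ³∖{0}` (centres in a countable dense set, radii `1/(m+1)`);
* `ae_eq_of_tendsto_setLIntegral_sq` — two `L²(A)` limits of one sequence agree a.e. on `A`;
* `exists_glued_limit` — if `P_j → P^{(k)}` in `L²(B(c_k, r_k))` for every `k`, then the first-ball
  gluing `P` (`P = P^{(k)}` a.e. on each ball) is measurable and `P_j → P` in `L²(K)`, `∫_K|P|² < ∞`,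
  for every compact `K ⊆ ℝ³∖{0}` (finite subcover).
The analysis (local split, Weyl representatives, diagonal extraction) and the binder
`step_construct_pieceB` are in `SoloSalvageWu2026PressureCompact`.

WHAT THIS IS NOT: not a proof of `Step_construct`; not a claim about NS regularity or blow-up; not
a claim about any author beyond the typed locator.
-/

noncomputable section

set_option linter.dupNamespace false

open MeasureTheory Set Function Filter Topology Metric
open scoped ENNReal NNReal RealInnerProductSpace ContDiff

namespace Summit.NavierStokesRegularity.NavierStokesRegularity.Theorems.Wu2026Salvage

open Literature.Claims.NS.Wu2026 Literature.Analysis.FluidPDE Literature.Analysis.FunctionSpaces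

-- nested operator types in the imported pressure files
set_option maxSynthPendingDepth 3

/-! ### A countable cover of `ℝ³ ∖ {0}` by good balls -/

/-- **Good balls**: a sequence of balls `B(c_k, r_k)`, `r_k > 0`, with `B̄(c_k, 3r_k) ⊆ ℝ³ ∖ {0}`,
covering `ℝ³ ∖ {0}` (centres from a countable dense set, radii `1/(m+1)`: for `y ≠ 0` take
`1/(m+1) < |y|/4` and a dense point within `r/2` of `y`) — the «nested exhaustion of R³∖{0}» of
p.16 l.3 in countable-cover form. [cite: Wu2026, p.16 l.1–6] -/
theorem exists_goodBalls : ∃ (ctr : ℕ → E3) (rad : ℕ → ℝ), (∀ k, 0 < rad k) ∧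
    (∀ k, closedBall (ctr k) (3 * rad k) ⊆ punctured) ∧
    punctured ⊆ ⋃ k, ball (ctr k) (rad k) := by
  obtain ⟨D, hDc, hDd⟩ := TopologicalSpace.exists_countable_dense E3
  haveI : Countable D := hDc.to_subtype
  let G : Type := {q : D × ℕ // 3 * (1 / ((q.2 : ℝ) + 1)) < ‖(q.1 : E3)‖}
  -- `G` is nonempty: a dense point of norm `> 3`
  obtain ⟨e₀⟩ : Nonempty E3 := inferInstance
  have hne : Nonempty G := by
    obtain ⟨z, hz⟩ : ∃ z : E3, 4 < ‖z‖ := by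
      obtain ⟨z, hz⟩ := NormedSpace.exists_lt_norm ℝ E3 4
      exact ⟨z, hz⟩
    obtain ⟨d, hdD, hdz⟩ := hDd.exists_dist_lt z one_pos
    refine ⟨⟨(⟨d, hdD⟩, 0), ?_⟩⟩
    have h1 : ‖z‖ - 1 < ‖d‖ := by
      have := norm_sub_norm_le z d
      rw [← dist_eq_norm] at this
      linarith
    simp only [Nat.cast_zero, zero_add, div_one, mul_one]
    linarith
  obtain ⟨e, he⟩ := exists_surjective_nat G
  refine ⟨fun k => ((e k).1.1 : E3), fun k => 1 / (((e k).1.2 : ℝ) + 1), fun k => by positivity,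
    fun k y hy => ?_, fun y hy => ?_⟩
  · -- `B̄(c, 3r) ⊆ ℝ³ ∖ {0}` since `3r < |c|`
    have hlt := (e k).2
    rw [mem_closedBall, dist_eq_norm] at hy
    intro h0
    rw [show y = 0 from h0, zero_sub, norm_neg] at hy
    linarith
  · -- cover
    have hy0 : 0 < ‖y‖ := norm_pos_iff.2 hy
    obtain ⟨m, hm⟩ := exists_nat_one_div_lt (by positivity : 0 < ‖y‖ / 4)
    set r : ℝ := 1 / ((m : ℝ) + 1) with hr
    have hr0 : 0 < r := by positivity
    obtain ⟨d, hdD, hdy⟩ := hDd.exists_dist_lt y (half_pos hr0)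
    have hgood : 3 * (1 / ((m : ℝ) + 1)) < ‖d‖ := by
      have h1 : ‖y‖ - r / 2 < ‖d‖ := by
        have := norm_sub_norm_le y d
        rw [← dist_eq_norm] at this
        linarith
      rw [← hr]
      linarith
    obtain ⟨k, hk⟩ := he ⟨(⟨d, hdD⟩, m), hgood⟩
    refine mem_iUnion.2 ⟨k, ?_⟩
    have h1 : ((e k).1.1 : E3) = d := by rw [hk]
    have h2 : (((e k).1.2 : ℕ) : ℝ) = m := by rw [hk]
    show y ∈ ball ((e k).1.1 : E3) (1 / ((((e k).1.2 : ℕ) : ℝ) + 1))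
    rw [h1, h2, mem_ball, ← hr]
    linarith

/-! ### Uniqueness of `L²` limits on a set -/

/-- Two `L²(A)` limits of one sequence agree a.e. on `A`. [folklore] -/
theorem ae_eq_of_tendsto_setLIntegral_sq {f : ℕ → E3 → ℝ} {g g' : E3 → ℝ} {A : Set E3}
    (hfm : ∀ j, AEStronglyMeasurable (f j) volume) (hgm : AEStronglyMeasurable g volume)
    (hg'm : AEStronglyMeasurable g' volume)
    (hg : Tendsto (fun j => ∫⁻ y in A, ‖f j y - g y‖ₑ ^ (2 : ℝ)) atTop (𝓝 0))
    (hg' : Tendsto (fun j => ∫⁻ y in A, ‖f j y - g' y‖ₑ ^ (2 : ℝ)) atTop (𝓝 0)) :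
    ∀ᵐ y ∂(volume.restrict A), g y = g' y := by
  have hle : ∀ j, ∫⁻ y in A, ‖g y - g' y‖ₑ ^ (2 : ℝ) ≤
      2 * ((∫⁻ y in A, ‖f j y - g y‖ₑ ^ (2 : ℝ)) + ∫⁻ y in A, ‖f j y - g' y‖ₑ ^ (2 : ℝ)) := by
    intro j
    have hmeas : AEMeasurable (fun y => ‖f j y - g y‖ₑ ^ (2 : ℝ)) (volume.restrict A) :=
      (((hfm j).sub hgm).enorm.pow_const _).restrict
    calc ∫⁻ y in A, ‖g y - g' y‖ₑ ^ (2 : ℝ)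
        ≤ ∫⁻ y in A, 2 * (‖f j y - g y‖ₑ ^ (2 : ℝ) + ‖f j y - g' y‖ₑ ^ (2 : ℝ)) := by
          refine lintegral_mono fun y => ?_
          have e : g y - g' y = -(f j y - g y) + (f j y - g' y) := by ring
          rw [e]
          calc ‖-(f j y - g y) + (f j y - g' y)‖ₑ ^ (2 : ℝ)
              ≤ (‖-(f j y - g y)‖ₑ + ‖f j y - g' y‖ₑ) ^ (2 : ℝ) :=
                ENNReal.rpow_le_rpow (enorm_add_le _ _) (by norm_num)
            _ ≤ (2 : ℝ≥0∞) ^ ((2 : ℝ) - 1) * (‖-(f j y - g y)‖ₑ ^ (2 : ℝ) + ‖f j y - g' y‖ₑ ^ (2 : ℝ)) :=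
                ENNReal.rpow_add_le_mul_rpow_add_rpow _ _ (by norm_num)
            _ = 2 * (‖f j y - g y‖ₑ ^ (2 : ℝ) + ‖f j y - g' y‖ₑ ^ (2 : ℝ)) := by
                rw [enorm_neg]; norm_num
      _ = 2 * ((∫⁻ y in A, ‖f j y - g y‖ₑ ^ (2 : ℝ)) + ∫⁻ y in A, ‖f j y - g' y‖ₑ ^ (2 : ℝ)) := by
          rw [lintegral_const_mul' _ _ ENNReal.ofNat_ne_top, lintegral_add_left' hmeas]
  have hlim : Tendsto (fun j => 2 * ((∫⁻ y in A, ‖f j y - g y‖ₑ ^ (2 : ℝ)) +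
      ∫⁻ y in A, ‖f j y - g' y‖ₑ ^ (2 : ℝ))) atTop (𝓝 0) := by
    simpa using ENNReal.Tendsto.const_mul (hg.add hg') (Or.inr ENNReal.ofNat_ne_top)
  have h0 : ∫⁻ y in A, ‖g y - g' y‖ₑ ^ (2 : ℝ) = 0 :=
    le_antisymm (ge_of_tendsto hlim (Eventually.of_forall hle)) zero_le
  have hmeas' : AEMeasurable (fun y => ‖g y - g' y‖ₑ ^ (2 : ℝ)) (volume.restrict A) :=
    ((hgm.sub hg'm).enorm.pow_const _).restrict
  have hae := (lintegral_eq_zero_iff' hmeas').1 h0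
  filter_upwards [hae] with y hy
  have h1 : ‖g y - g' y‖ₑ = 0 := by
    simpa [ENNReal.rpow_eq_zero_iff] using hy
  rw [enorm_eq_zero, sub_eq_zero] at h1
  exact h1


/-! ### Gluing ball-wise limits -/

/-- **Gluing** (the «nested exhaustion of R³∖{0}» step, p.16 l.3–6): let balls `B_k = B(c_k, r_k)`
cover `ℝ³ ∖ {0}` and let measurable `P_j` converge in `L²(B_k)` to `P^{(k)}` with `∫_{B_k}|P^{(k)}|² < ∞`
for every `k`. Then there is ONE measurable `P` (the gluing along the first ball containing a
point; `P = P^{(k)}` a.e. on `B_k` by uniqueness of `L²` limits) with `∫_K |P|² < ∞` and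
`∫_K |P_j − P|² → 0` for every compact `K ⊆ ℝ³ ∖ {0}`. [cite: Wu2026, p.16 l.3–6] -/
theorem exists_glued_limit {Pj : ℕ → E3 → ℝ} (hPjm : ∀ j, AEStronglyMeasurable (Pj j) volume)
    {ctr : ℕ → E3} {rad : ℕ → ℝ} (hcov : punctured ⊆ ⋃ k, ball (ctr k) (rad k))
    {Plim : ℕ → E3 → ℝ} (hPlm : ∀ k, AEStronglyMeasurable (Plim k) volume)
    (hfin : ∀ k, ∫⁻ y in ball (ctr k) (rad k), ‖Plim k y‖ₑ ^ (2 : ℝ) < ⊤)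
    (hconv : ∀ k, Tendsto (fun j => ∫⁻ y in ball (ctr k) (rad k), ‖Pj j y - Plim k y‖ₑ ^ (2 : ℝ))
      atTop (𝓝 0)) :
    ∃ P : E3 → ℝ, AEStronglyMeasurable P volume ∧ ∀ K : Set E3, IsCompact K → K ⊆ punctured →
      (∫⁻ y in K, ‖P y‖ₑ ^ (2 : ℝ)) < ⊤ ∧
      Tendsto (fun j => ∫⁻ y in K, ‖Pj j y - P y‖ₑ ^ (2 : ℝ)) atTop (𝓝 0) := by
  classical
  set Bk : ℕ → Set E3 := fun k => ball (ctr k) (rad k) with hBk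
  let P : E3 → ℝ := fun y => if h : ∃ k, y ∈ Bk k then Plim (Nat.find h) y else 0
  -- limits agree a.e. on overlaps
  have hagree : ∀ k k', ∀ᵐ y ∂(volume.restrict (Bk k)), y ∈ Bk k' → Plim k' y = Plim k y := by
    intro k k'
    have hsub1 : Bk k' ∩ Bk k ⊆ Bk k' := inter_subset_left
    have hsub2 : Bk k' ∩ Bk k ⊆ Bk k := inter_subset_right
    have hc1 : Tendsto (fun j => ∫⁻ y in Bk k' ∩ Bk k, ‖Pj j y - Plim k' y‖ₑ ^ (2 : ℝ)) atTop (𝓝 0) :=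
      tendsto_of_tendsto_of_tendsto_of_le_of_le tendsto_const_nhds (hconv k') (fun j => zero_le)
        fun j => lintegral_mono_set hsub1
    have hc2 : Tendsto (fun j => ∫⁻ y in Bk k' ∩ Bk k, ‖Pj j y - Plim k y‖ₑ ^ (2 : ℝ)) atTop (𝓝 0) :=
      tendsto_of_tendsto_of_tendsto_of_le_of_le tendsto_const_nhds (hconv k) (fun j => zero_le)
        fun j => lintegral_mono_set hsub2
    have h := ae_eq_of_tendsto_setLIntegral_sq hPjm (hPlm k') (hPlm k) hc1 hc2
    rw [← Measure.restrict_restrict measurableSet_ball] at h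
    exact (ae_restrict_iff' measurableSet_ball).1 h
  -- `P = P^{(k)}` a.e. on `B_k`
  have hPk : ∀ k, ∀ᵐ y ∂(volume.restrict (Bk k)), P y = Plim k y := by
    intro k
    filter_upwards [ae_all_iff.2 (hagree k), ae_restrict_mem measurableSet_ball] with y hall hy
    have hex : ∃ k', y ∈ Bk k' := ⟨k, hy⟩
    show (if h : ∃ k', y ∈ Bk k' then Plim (Nat.find h) y else 0) = Plim k y
    rw [dif_pos hex]
    exact hall _ (Nat.find_spec hex)
  -- measurability
  have hPm : AEStronglyMeasurable P volume := by
    have hU : AEStronglyMeasurable P (volume.restrict (⋃ k, Bk k)) :=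
      aestronglyMeasurable_iUnion_iff.2 fun k =>
        (hPlm k).restrict.congr (EventuallyEq.symm (hPk k))
    have hae : ∀ᵐ y ∂(volume : Measure E3), y ∈ ⋃ k, Bk k := by
      have h0 : ∀ᵐ y ∂(volume : Measure E3), y ∉ ({0} : Set E3) :=
        measure_eq_zero_iff_ae_notMem.1 (measure_singleton 0)
      filter_upwards [h0] with y hy
      exact hcov hy
    rwa [Measure.restrict_eq_self_of_ae_mem hae] at hU
  refine ⟨P, hPm, fun K hK hKp => ?_⟩
  obtain ⟨t, ht⟩ := hK.elim_finite_subcover (fun k => Bk k) (fun k => isOpen_ball) (hKp.trans hcov)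
  have hsum : ∀ f : E3 → ℝ≥0∞, ∫⁻ y in K, f y ≤ ∑ k ∈ t, ∫⁻ y in Bk k, f y := fun f =>
    (lintegral_mono_set ht).trans (lintegral_biUnion_finset_le t Bk f)
  refine ⟨?_, ?_⟩
  · refine (hsum _).trans_lt (ENNReal.sum_lt_top.2 fun k _ => ?_)
    calc ∫⁻ y in Bk k, ‖P y‖ₑ ^ (2 : ℝ) = ∫⁻ y in Bk k, ‖Plim k y‖ₑ ^ (2 : ℝ) :=
          lintegral_congr_ae ((hPk k).mono fun y hy => by
            show ‖P y‖ₑ ^ (2 : ℝ) = ‖Plim k y‖ₑ ^ (2 : ℝ); rw [hy])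
      _ < ⊤ := hfin k
  · have hlim : Tendsto (fun j => ∑ k ∈ t, ∫⁻ y in Bk k, ‖Pj j y - P y‖ₑ ^ (2 : ℝ)) atTop (𝓝 0) := by
      rw [show (0 : ℝ≥0∞) = ∑ k ∈ t, 0 by simp]
      refine tendsto_finsetSum t fun k _ => ?_
      have e : ∀ j, ∫⁻ y in Bk k, ‖Pj j y - P y‖ₑ ^ (2 : ℝ) =
          ∫⁻ y in Bk k, ‖Pj j y - Plim k y‖ₑ ^ (2 : ℝ) := fun j =>
        lintegral_congr_ae ((hPk k).mono fun y hy => by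
          show ‖Pj j y - P y‖ₑ ^ (2 : ℝ) = ‖Pj j y - Plim k y‖ₑ ^ (2 : ℝ); rw [hy])
      simp_rw [e]
      exact hconv k
    exact tendsto_of_tendsto_of_tendsto_of_le_of_le tendsto_const_nhds hlim (fun j => zero_le)
      fun j => hsum _

end Summit.NavierStokesRegularity.NavierStokesRegularity.Theorems.Wu2026Salvage

end

-- WHAT THIS IS NOT: not a claim about NS regularity or blow-up; not a claim about any author beyond the typed locator.
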